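import Mathlib.Analysis.SpecialFunctions.Trigonometric.Series
import Mathlib.Analysis.SpecialFunctions.Complex.LogBounds
import Mathlib.Analysis.Complex.Exponential
import Literature.MathematicalPhysics.QuantumLattice.DWaveSourceFreeLeeYang
import Literature.MathematicalPhysics.QuantumLattice.DWaveSourceFreeGainBound

/-!
# The free `d`-wave–sourced torus at COMPLEX source: BdG mode factors and the entire product formula

Topic `MathematicalPhysics/QuantumLattice` (companion of `DWaveSourceFreePressure.lean`,
`DWaveSourceFreeLeeYang.lean`, `BdGModeGainBound.lean`). For the `U = 0` Hubbard torus in the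
`d`-wave pair source, `Z_L(h) = tr e^{-β(hubbardTorusWith 2 L 1 0 μ - h(Δ_d + Δ_d†))}` is an entire
function of the complex source `h`, given by the BdG product over torus momenta with the entire
function `C(w) = cosh(β√w)` (`C(z²) = cosh(βz)`, `DWaveSourceFreeLeeYang.exists_coshSqrt`):

* `partitionFn_dWaveSource_free_eq_prod` — **the product formula at complex source**,
  `Z_L(h) = 2^{|Orb|} Π_k e^{-βξ_k}(1 + C(ξ_k² + (2√2 h ĝ_d(k))²))/2` (`L ≥ 3`; identity theorem from the
  real-source formula `partitionFn_dWaveSourceTorus_zero` — the step used inside the free Lee–Yang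
  theorem, exported);
* `norm_coshSqrt_sub_le` — **real majorant**: `‖C(x + v) - C(x)‖ ≤ cosh(β√(x + ‖v‖)) - cosh(β√x)` for
  real `x ≥ 0`, complex `v` (termwise domination of the power series `C(w) = Σ β²ⁿwⁿ/(2n)!`,
  `hasSum_coshSqrt`, by `‖(x+v)ʲ - xʲ‖ ≤ (x+‖v‖)ʲ - xʲ`, `norm_add_pow_sub_pow_le`);
* `norm_bdgModeRatio_sub_one_le` — **the mode factor at complex source is close to its zero-source
  value**: with `x = β·8‖h‖²g²·β/(2+β|ξ|) ≤ 1`,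
  `‖(1 + C(ξ² + (2√2 h g)²))/(1 + cosh βξ) - 1‖ ≤ 2x` (majorant + the real per-mode gain bound
  `bdgModeGain_le`: `log R ≤ x`, so `R - 1 ≤ e^x - 1 ≤ 2x`); hence for `x ≤ 1/4` the ratio is in the
  slit plane (`bdgModeRatio_mem_slitPlane`) with `‖log ratio‖ ≤ 3x` (`norm_log_bdgModeRatio_le`).

These are the inputs of the Cauchy estimate for the zero-source pair-field cumulants of the free
torus (`DWaveSourceFreeCumulantBound.lean`). Everything is PROVED; no definition is introduced.

## References

* J. von Delft, D. C. Ralph, Phys. Rep. 345 (2001) 61, §4.2 (BdG partition function).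
  [VondelftRalph2001]
* D. Ruelle, *Statistical Mechanics: Rigorous Results* (1969), §4.4. [Ruelle1969]
-/

noncomputable section

open Complex Finset Filter Metric Set
open scoped Nat Topology Matrix.Norms.L2Operator ComplexOrder
open Matrix Literature.Probability.LatticeModels

namespace Literature.MathematicalPhysics.QuantumLattice


/-! ### A real majorant for `cosh(β√w)` off the real axis -/

/-- `‖(x + v)ʲ - xʲ‖ ≤ (x + ‖v‖)ʲ - xʲ` for real `x ≥ 0` and complex `v` (expand and bound every
cross term). [folklore] -/
theorem norm_add_pow_sub_pow_le {x : ℝ} (hx : 0 ≤ x) (v : ℂ) (j : ℕ) :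
    ‖((x : ℂ) + v) ^ j - (x : ℂ) ^ j‖ ≤ (x + ‖v‖) ^ j - x ^ j := by
  induction j with
  | zero => simp
  | succ j ih =>
    have hsplit : ((x : ℂ) + v) ^ (j + 1) - (x : ℂ) ^ (j + 1) =
        ((x : ℂ) + v) * (((x : ℂ) + v) ^ j - (x : ℂ) ^ j) + v * (x : ℂ) ^ j := by ring
    have hxv : ‖(x : ℂ) + v‖ ≤ x + ‖v‖ := by
      calc ‖(x : ℂ) + v‖ ≤ ‖(x : ℂ)‖ + ‖v‖ := norm_add_le _ _
        _ = x + ‖v‖ := by rw [Complex.norm_real, Real.norm_eq_abs, abs_of_nonneg hx]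
    have hxj : ‖(x : ℂ) ^ j‖ = x ^ j := by
      rw [norm_pow, Complex.norm_real, Real.norm_eq_abs, abs_of_nonneg hx]
    have hpos : 0 ≤ (x + ‖v‖) ^ j - x ^ j := by
      have : x ^ j ≤ (x + ‖v‖) ^ j :=
        pow_le_pow_left₀ hx (le_add_of_nonneg_right (norm_nonneg v)) j
      linarith
    rw [hsplit]
    calc ‖((x : ℂ) + v) * (((x : ℂ) + v) ^ j - (x : ℂ) ^ j) + v * (x : ℂ) ^ j‖
        ≤ ‖((x : ℂ) + v) * (((x : ℂ) + v) ^ j - (x : ℂ) ^ j)‖ + ‖v * (x : ℂ) ^ j‖ := norm_add_le _ _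
      _ = ‖(x : ℂ) + v‖ * ‖((x : ℂ) + v) ^ j - (x : ℂ) ^ j‖ + ‖v‖ * x ^ j := by
          rw [norm_mul, norm_mul, hxj]
      _ ≤ (x + ‖v‖) * ((x + ‖v‖) ^ j - x ^ j) + ‖v‖ * x ^ j := by
          gcongr
      _ = (x + ‖v‖) ^ (j + 1) - x ^ (j + 1) := by ring

/-- The power series of `cosh(β√w)`: if `C(z²) = cosh(βz)` for all `z`, then
`C w = Σₙ β²ⁿ wⁿ/(2n)!` for every complex `w`. [folklore] -/
theorem hasSum_coshSqrt {β : ℝ} {C : ℂ → ℂ} (hCsq : ∀ z : ℂ, C (z ^ 2) = Complex.cosh ((β : ℂ) * z))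
    (w : ℂ) : HasSum (fun n : ℕ => (β : ℂ) ^ (2 * n) * w ^ n / ((2 * n) ! : ℂ)) (C w) := by
  have hsq : (w ^ (2⁻¹ : ℂ)) ^ 2 = w := by
    have h := Complex.cpow_nat_inv_pow w (n := 2) two_ne_zero
    rwa [Nat.cast_ofNat] at h
  have hC : C w = Complex.cosh ((β : ℂ) * w ^ (2⁻¹ : ℂ)) := by rw [← hCsq, hsq]
  rw [hC]
  have := Complex.hasSum_cosh ((β : ℂ) * w ^ (2⁻¹ : ℂ))
  convert this using 2 with n
  rw [mul_pow, pow_mul, pow_mul, hsq]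

/-- The real power series: `cosh(β√y) = Σₙ β²ⁿ yⁿ/(2n)!` for `y ≥ 0`. [folklore] -/
theorem hasSum_cosh_mul_sqrt (β : ℝ) {y : ℝ} (hy : 0 ≤ y) :
    HasSum (fun n : ℕ => β ^ (2 * n) * y ^ n / ((2 * n) ! : ℝ)) (Real.cosh (β * Real.sqrt y)) := by
  have := Real.hasSum_cosh (β * Real.sqrt y)
  convert this using 2 with n
  rw [mul_pow, pow_mul, pow_mul, Real.sq_sqrt hy]

/-- **Real majorant.** If `C(z²) = cosh(βz)`, then for real `x ≥ 0` and complex `v`,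
`‖C(x + v) - C(x)‖ ≤ cosh(β√(x + ‖v‖)) - cosh(β√x)`: termwise domination of the power series in
`w` by `norm_add_pow_sub_pow_le`. [folklore] -/
theorem norm_coshSqrt_sub_le {β : ℝ} {C : ℂ → ℂ}
    (hCsq : ∀ z : ℂ, C (z ^ 2) = Complex.cosh ((β : ℂ) * z)) {x : ℝ} (hx : 0 ≤ x) (v : ℂ) :
    ‖C ((x : ℂ) + v) - C (x : ℂ)‖ ≤
      Real.cosh (β * Real.sqrt (x + ‖v‖)) - Real.cosh (β * Real.sqrt x) := by
  have h1 := hasSum_coshSqrt hCsq ((x : ℂ) + v)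
  have h2 := hasSum_coshSqrt hCsq (x : ℂ)
  have hdiff : HasSum (fun n : ℕ => (β : ℂ) ^ (2 * n) * (((x : ℂ) + v) ^ n - (x : ℂ) ^ n) / ((2 * n) ! : ℂ))
      (C ((x : ℂ) + v) - C (x : ℂ)) := by
    have e : (fun n : ℕ => (β : ℂ) ^ (2 * n) * (((x : ℂ) + v) ^ n - (x : ℂ) ^ n) / ((2 * n) ! : ℂ)) =
        fun n : ℕ => (β : ℂ) ^ (2 * n) * ((x : ℂ) + v) ^ n / ((2 * n) ! : ℂ) -
          (β : ℂ) ^ (2 * n) * (x : ℂ) ^ n / ((2 * n) ! : ℂ) := funext fun n => by ring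
    rw [e]
    exact h1.sub h2
  have r1 := hasSum_cosh_mul_sqrt β (add_nonneg hx (norm_nonneg v))
  have r2 := hasSum_cosh_mul_sqrt β hx
  have rdiff : HasSum (fun n : ℕ => β ^ (2 * n) * ((x + ‖v‖) ^ n - x ^ n) / ((2 * n) ! : ℝ))
      (Real.cosh (β * Real.sqrt (x + ‖v‖)) - Real.cosh (β * Real.sqrt x)) := by
    have e : (fun n : ℕ => β ^ (2 * n) * ((x + ‖v‖) ^ n - x ^ n) / ((2 * n) ! : ℝ)) =
        fun n : ℕ => β ^ (2 * n) * (x + ‖v‖) ^ n / ((2 * n) ! : ℝ) -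
          β ^ (2 * n) * x ^ n / ((2 * n) ! : ℝ) := funext fun n => by ring
    rw [e]
    exact r1.sub r2
  have hle : ∀ n : ℕ, ‖(β : ℂ) ^ (2 * n) * (((x : ℂ) + v) ^ n - (x : ℂ) ^ n) / ((2 * n) ! : ℂ)‖ ≤
      β ^ (2 * n) * ((x + ‖v‖) ^ n - x ^ n) / ((2 * n) ! : ℝ) := by
    intro n
    rw [norm_div, norm_mul, norm_pow, Complex.norm_real, Real.norm_eq_abs, Complex.norm_natCast]
    have hβ : |β| ^ (2 * n) = β ^ (2 * n) := by rw [pow_mul, pow_mul, sq_abs]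
    rw [hβ]
    have hfac : (0 : ℝ) < ((2 * n) ! : ℝ) := by positivity
    have hβn : (0 : ℝ) ≤ β ^ (2 * n) := by rw [pow_mul]; positivity
    exact div_le_div_of_nonneg_right (mul_le_mul_of_nonneg_left (norm_add_pow_sub_pow_le hx v n)
      hβn) hfac.le
  calc ‖C ((x : ℂ) + v) - C (x : ℂ)‖
      = ‖∑' n : ℕ, (β : ℂ) ^ (2 * n) * (((x : ℂ) + v) ^ n - (x : ℂ) ^ n) / ((2 * n) ! : ℂ)‖ := by
        rw [hdiff.tsum_eq]
    _ ≤ Real.cosh (β * Real.sqrt (x + ‖v‖)) - Real.cosh (β * Real.sqrt x) :=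
        tsum_of_norm_bounded rdiff hle


/-! ### The BdG mode factor at complex source -/

/-- **The relative size of the BdG mode factor at complex source.** Let `C(z²) = cosh(βz)` (`β > 0`),
`ξ, g` real and `h` complex, and put `x = β · 8‖h‖²g² · β/(2 + β|ξ|)`. If `x ≤ 1` then
`‖(1 + C(ξ² + (2√2·h·g)²))/(1 + cosh βξ) - 1‖ ≤ 2x`:
the real majorant `norm_coshSqrt_sub_le` reduces this to the real per-mode gain bound
`bdgModeGain_le` (`log R ≤ x`, hence `R - 1 ≤ e^x - 1 ≤ 2x`). [folklore] -/
theorem norm_bdgModeRatio_sub_one_le {β : ℝ} (hβ : 0 < β) {C : ℂ → ℂ}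
    (hCsq : ∀ z : ℂ, C (z ^ 2) = Complex.cosh ((β : ℂ) * z)) (ξ g : ℝ) (h : ℂ)
    (hx : β * (8 * ‖h‖ ^ 2 * g ^ 2) * (β / (2 + β * |ξ|)) ≤ 1) :
    ‖(1 + C ((ξ : ℂ) ^ 2 + ((2 * Real.sqrt 2 : ℂ) * h * (g : ℂ)) ^ 2)) /
        (1 + Complex.cosh ((β : ℂ) * ξ)) - 1‖ ≤
      2 * (β * (8 * ‖h‖ ^ 2 * g ^ 2) * (β / (2 + β * |ξ|))) := by
  set v : ℂ := ((2 * Real.sqrt 2 : ℂ) * h * (g : ℂ)) ^ 2 with hvdef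
  set t : ℝ := 8 * ‖h‖ ^ 2 * g ^ 2 with htdef
  have ht0 : 0 ≤ t := by positivity
  have hnv : ‖v‖ = t := by
    rw [hvdef, htdef, norm_pow, norm_mul, norm_mul, Complex.norm_real, Real.norm_eq_abs]
    have h2 : ‖(2 * Real.sqrt 2 : ℂ)‖ = 2 * Real.sqrt 2 := by
      rw [show (2 * Real.sqrt 2 : ℂ) = ((2 * Real.sqrt 2 : ℝ) : ℂ) by push_cast; ring,
        Complex.norm_real, Real.norm_eq_abs, abs_of_nonneg (by positivity)]
    rw [h2, mul_pow, mul_pow, mul_pow, Real.sq_sqrt zero_le_two, sq_abs]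
    ring
  -- the denominators
  have hden : (1 : ℂ) + Complex.cosh ((β : ℂ) * ξ) = ((1 + Real.cosh (β * ξ) : ℝ) : ℂ) := by
    rw [Complex.ofReal_add, Complex.ofReal_one, Complex.ofReal_cosh, Complex.ofReal_mul]
  have hdpos : 0 < 1 + Real.cosh (β * ξ) := by
    have := Real.cosh_pos (β * ξ); linarith
  -- `C(ξ²) = cosh βξ`
  have hC0 : C ((ξ : ℂ) ^ 2) = Complex.cosh ((β : ℂ) * ξ) := hCsq ξ
  -- rewrite the ratio minus one as `(C(ξ²+v) - C(ξ²))/(1 + cosh βξ)`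
  have hrw : (1 + C ((ξ : ℂ) ^ 2 + v)) / (1 + Complex.cosh ((β : ℂ) * ξ)) - 1 =
      (C ((ξ : ℂ) ^ 2 + v) - C ((ξ : ℂ) ^ 2)) / (1 + Complex.cosh ((β : ℂ) * ξ)) := by
    have hne : (1 : ℂ) + Complex.cosh ((β : ℂ) * ξ) ≠ 0 := by
      rw [hden]; exact_mod_cast hdpos.ne'
    rw [div_sub_one hne, hC0]
    congr 1
    ring
  rw [hrw, norm_div, hden, Complex.norm_real, Real.norm_eq_abs, abs_of_pos hdpos,
    div_le_iff₀ hdpos]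
  -- the real majorant
  have hmaj := norm_coshSqrt_sub_le hCsq (sq_nonneg ξ) v
  rw [hnv] at hmaj
  have hξ2 : ((ξ ^ 2 : ℝ) : ℂ) = (ξ : ℂ) ^ 2 := by push_cast; ring
  rw [hξ2] at hmaj
  -- real per-mode gain: `R ≤ exp x`
  set D : ℝ := Real.sqrt t with hD
  have hD2 : D ^ 2 = t := Real.sq_sqrt ht0
  set x : ℝ := β * t * (β / (2 + β * |ξ|)) with hxdef
  have hx0 : 0 ≤ x := by positivity
  have hgain := bdgModeGain_le hβ ξ D
  rw [hD2] at hgain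
  have hnum_pos : 0 < 1 + Real.cosh (β * Real.sqrt (ξ ^ 2 + t)) := by
    have := Real.cosh_pos (β * Real.sqrt (ξ ^ 2 + t)); linarith
  have hR : (1 + Real.cosh (β * Real.sqrt (ξ ^ 2 + t))) / (1 + Real.cosh (β * ξ)) ≤ Real.exp x := by
    have h1 : Real.log ((1 + Real.cosh (β * Real.sqrt (ξ ^ 2 + t))) / (1 + Real.cosh (β * ξ))) ≤ x := by
      rw [Real.log_div hnum_pos.ne' hdpos.ne']
      have e1 : Real.log ((1 + Real.cosh (β * Real.sqrt (ξ ^ 2 + t))) / 2) -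
          Real.log ((1 + Real.cosh (β * ξ)) / 2) =
          Real.log (1 + Real.cosh (β * Real.sqrt (ξ ^ 2 + t))) - Real.log (1 + Real.cosh (β * ξ)) := by
        rw [Real.log_div hnum_pos.ne' two_ne_zero, Real.log_div hdpos.ne' two_ne_zero]; ring
      rw [← e1]; exact hgain
    have := Real.exp_le_exp.mpr h1
    rwa [Real.exp_log (div_pos hnum_pos hdpos)] at this
  have hx1 : x ≤ 1 := hx
  have hR' : 1 + Real.cosh (β * Real.sqrt (ξ ^ 2 + t)) ≤ (1 + 2 * x) * (1 + Real.cosh (β * ξ)) := by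
    rw [div_le_iff₀ hdpos] at hR
    -- `e^x ≤ 1 + 2x` on `[0,1]`
    have hexp : Real.exp x ≤ 1 + 2 * x := by
      have h := Real.abs_exp_sub_one_sub_id_le (x := x) (by rw [abs_of_nonneg hx0]; exact hx1)
      have h2 : Real.exp x - 1 - x ≤ x ^ 2 := (le_abs_self _).trans h
      nlinarith
    exact hR.trans (mul_le_mul_of_nonneg_right hexp hdpos.le)
  -- `cosh(β√(ξ²)) = cosh(βξ)`
  have hsq : Real.cosh (β * Real.sqrt (ξ ^ 2)) = Real.cosh (β * ξ) := by
    rw [Real.sqrt_sq_eq_abs]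
    rcases abs_choice ξ with h | h <;> rw [h]
    rw [mul_neg, Real.cosh_neg]
  rw [hsq] at hmaj
  calc ‖C ((ξ : ℂ) ^ 2 + v) - C ((ξ : ℂ) ^ 2)‖
      ≤ Real.cosh (β * Real.sqrt (ξ ^ 2 + t)) - Real.cosh (β * ξ) := hmaj
    _ ≤ 2 * x * (1 + Real.cosh (β * ξ)) := by nlinarith
    _ = 2 * (β * (8 * ‖h‖ ^ 2 * g ^ 2) * (β / (2 + β * |ξ|))) * (1 + Real.cosh (β * ξ)) := by
        rw [hxdef, htdef]

/-- **Logarithm of the mode ratio.** Under `x ≤ 1/4` (notation of `norm_bdgModeRatio_sub_one_le`) the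
mode ratio lies within `1/2` of `1`, so its principal logarithm is bounded by `3x`. [folklore] -/
theorem norm_log_bdgModeRatio_le {β : ℝ} (hβ : 0 < β) {C : ℂ → ℂ}
    (hCsq : ∀ z : ℂ, C (z ^ 2) = Complex.cosh ((β : ℂ) * z)) (ξ g : ℝ) (h : ℂ)
    (hx : β * (8 * ‖h‖ ^ 2 * g ^ 2) * (β / (2 + β * |ξ|)) ≤ 1 / 4) :
    ‖Complex.log ((1 + C ((ξ : ℂ) ^ 2 + ((2 * Real.sqrt 2 : ℂ) * h * (g : ℂ)) ^ 2)) /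
        (1 + Complex.cosh ((β : ℂ) * ξ)))‖ ≤
      3 * (β * (8 * ‖h‖ ^ 2 * g ^ 2) * (β / (2 + β * |ξ|))) := by
  set r := (1 + C ((ξ : ℂ) ^ 2 + ((2 * Real.sqrt 2 : ℂ) * h * (g : ℂ)) ^ 2)) /
        (1 + Complex.cosh ((β : ℂ) * ξ)) with hr
  set x := β * (8 * ‖h‖ ^ 2 * g ^ 2) * (β / (2 + β * |ξ|)) with hxdef
  have h1 : ‖r - 1‖ ≤ 2 * x := norm_bdgModeRatio_sub_one_le hβ hCsq ξ g h (by linarith)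
  have h2 : ‖r - 1‖ ≤ 1 / 2 := by linarith
  have h3 := Complex.norm_log_one_add_half_le_self h2
  rw [add_sub_cancel] at h3
  linarith

/-- The mode ratio is in the slit plane (it is within `1/2` of `1`) when `x ≤ 1/4`. [folklore] -/
theorem bdgModeRatio_mem_slitPlane {β : ℝ} (hβ : 0 < β) {C : ℂ → ℂ}
    (hCsq : ∀ z : ℂ, C (z ^ 2) = Complex.cosh ((β : ℂ) * z)) (ξ g : ℝ) (h : ℂ)
    (hx : β * (8 * ‖h‖ ^ 2 * g ^ 2) * (β / (2 + β * |ξ|)) ≤ 1 / 4) :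
    (1 + C ((ξ : ℂ) ^ 2 + ((2 * Real.sqrt 2 : ℂ) * h * (g : ℂ)) ^ 2)) /
        (1 + Complex.cosh ((β : ℂ) * ξ)) ∈ slitPlane := by
  set r := (1 + C ((ξ : ℂ) ^ 2 + ((2 * Real.sqrt 2 : ℂ) * h * (g : ℂ)) ^ 2)) /
        (1 + Complex.cosh ((β : ℂ) * ξ)) with hr
  have h1 : ‖r - 1‖ ≤ 1 / 2 := by
    have := norm_bdgModeRatio_sub_one_le hβ hCsq ξ g h (by linarith)
    linarith
  have : ‖r - 1‖ < 1 := by linarith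
  have hmem := Complex.mem_slitPlane_of_norm_lt_one this
  simpa using hmem


variable (L : ℕ) [NeZero L]

/-! ### The complex-source BdG product formula of the free torus -/

/-- **The BdG product formula at COMPLEX source** (`U = 0`, `L ≥ 3`): for any entire `C` with
`C(z²) = cosh(βz)`,
`Z_L(h) = 2^{|Orb|} Π_k e^{-βξ_k} (1 + C(ξ_k² + (2√2 h ĝ_d(k))²))/2` for every `h ∈ ℂ` — both sides are
entire and agree for real `h` (`partitionFn_dWaveSourceTorus_zero`). [cite: VondelftRalph2001, §4.2] -/
theorem partitionFn_dWaveSource_free_eq_prod (hL : 3 ≤ L) (β μ : ℝ) {C : ℂ → ℂ}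
    (hC : Differentiable ℂ C) (hCsq : ∀ z : ℂ, C (z ^ 2) = Complex.cosh ((β : ℂ) * z)) (h : ℂ) :
    partitionFn β (hubbardTorusWith 2 L 1 0 μ -
        h • (pairField dWaveFormFactor L + (pairField dWaveFormFactor L)ᴴ)) =
      (2 : ℂ) ^ Fintype.card (Orb (FermionTorus 2 L)) *
        ∏ k : TorusSite 2 L, ((Real.exp (-(β * (torusBand L k - μ))) : ℂ) *
          ((1 + C ((Complex.ofReal (torusBand L k - μ)) ^ 2 +
            ((2 * Real.sqrt 2 : ℂ) * h * (dWaveGap k : ℂ)) ^ 2)) / 2)) := by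
  set G : ℂ → ℂ := fun h => (2 : ℂ) ^ Fintype.card (Orb (FermionTorus 2 L)) *
    ∏ k : TorusSite 2 L, ((Real.exp (-(β * (torusBand L k - μ))) : ℂ) *
      ((1 + C ((Complex.ofReal (torusBand L k - μ)) ^ 2 +
        ((2 * Real.sqrt 2 : ℂ) * h * (dWaveGap k : ℂ)) ^ 2)) / 2)) with hGdef
  set F : ℂ → ℂ := fun h => partitionFn β (hubbardTorusWith 2 L 1 0 μ -
      h • (pairField dWaveFormFactor L + (pairField dWaveFormFactor L)ᴴ)) with hFdef
  have hFd : Differentiable ℂ F := differentiable_partitionFn_sub_smul β _ _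
  have hGd : Differentiable ℂ G := by
    have hmode : ∀ k : TorusSite 2 L, Differentiable ℂ (fun h : ℂ =>
        ((Real.exp (-(β * (torusBand L k - μ))) : ℂ) *
          ((1 + C ((Complex.ofReal (torusBand L k - μ)) ^ 2 +
            ((2 * Real.sqrt 2 : ℂ) * h * (dWaveGap k : ℂ)) ^ 2)) / 2))) := by
      intro k
      have hin : Differentiable ℂ (fun h : ℂ =>
          (Complex.ofReal (torusBand L k - μ)) ^ 2 + ((2 * Real.sqrt 2 : ℂ) * h * (dWaveGap k : ℂ)) ^ 2) := by
        fun_prop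
      have hc : Differentiable ℂ (fun h : ℂ =>
          C ((Complex.ofReal (torusBand L k - μ)) ^ 2 + ((2 * Real.sqrt 2 : ℂ) * h * (dWaveGap k : ℂ)) ^ 2)) :=
        hC.comp hin
      exact ((hc.const_add 1).div_const 2).const_mul _
    rw [hGdef]
    exact (Differentiable.fun_finsetProd (u := Finset.univ) fun k _ => hmode k).const_mul _
  have hagree : ∀ s : ℝ, F s = G s := by
    intro s
    rw [hFdef, hGdef]
    simp only
    have e : hubbardTorusWith 2 L 1 0 μ -
        (s : ℂ) • (pairField dWaveFormFactor L + (pairField dWaveFormFactor L)ᴴ) =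
          dWaveSourceTorus L 0 μ s := rfl
    rw [e, partitionFn_dWaveSourceTorus_zero hL β μ s]
    congr 1
    push_cast
    refine Finset.prod_congr rfl fun k _ => ?_
    congr 2
    have hnn : 0 ≤ (torusBand L k - μ) ^ 2 + (2 * Real.sqrt 2 * s * dWaveGap k) ^ 2 := by positivity
    have hr : ((Real.sqrt ((torusBand L k - μ) ^ 2 + (2 * Real.sqrt 2 * s * dWaveGap k) ^ 2) : ℂ)) ^ 2 =
        ((torusBand L k : ℂ) - (μ : ℂ)) ^ 2 + ((2 * Real.sqrt 2 : ℂ) * s * (dWaveGap k : ℂ)) ^ 2 := by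
      rw [← Complex.ofReal_pow, Real.sq_sqrt hnn]; push_cast; ring
    rw [← hr, hCsq]
  have hFG : F = G := by
    refine AnalyticOnNhd.eq_of_frequently_eq (z₀ := (0 : ℂ))
      (fun z _ => hFd.analyticAt z) (fun z _ => hGd.analyticAt z) ?_
    have ht : Tendsto (fun t : ℝ => (t : ℂ)) (𝓝[≠] 0) (𝓝[≠] 0) := by
      refine tendsto_nhdsWithin_iff.2 ⟨?_, ?_⟩
      · exact (Complex.continuous_ofReal.tendsto' 0 0 (by simp)).mono_left nhdsWithin_le_nhds
      · exact eventually_nhdsWithin_of_forall fun t ht => by simpa using ht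
    refine ht.frequently ?_
    exact Filter.Eventually.frequently (Filter.Eventually.of_forall hagree)
  exact congrFun hFG h

end Literature.MathematicalPhysics.QuantumLattice
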